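import Mathlib

/-!
# NoGo / EPhiImmuneC2 — scalar skeleton of THEOREM N19 (b) (= census-1 EPHI-1): the C = 2 row

search for candidate a priori estimates; no regularity claim.

Follow-up to `NoGo/EPhiImmune.lean` (filed p228874, three sign lemmas for the seven DEAD rows).
This file records the elementary real inequalities that make the EΦ.q=2.RQ.j=1 row HOLD with
C = 2 under DICTIONARY §5 E0 (reading W):  F = ∫ |ω|² ℓ,  ℓ = log (e + r) ≥ 1,  ρ = r/(e+r) ∈ [0,1).

* `tangential_ge_two`, `radial_ge_two` : the two eigenvalues of Hess (φ ∘ |·|), namely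
  φ′/s = 2ℓ + ρ and φ″ = 2ℓ + 3ρ + ρ(1-ρ), are ≥ 2, hence D_F ≥ 2νP.
* `viscous_bracket_nonpos` : with 0 ≤ 𝒥 ≤ Z and D ≥ 2νP the viscous bracket
  -D + (2νP/Z)𝒥 - (νZ/K)𝒥 is ≤ 0 (so V_F ≤ 0 identically and E0's first branch applies).
* `weight_nonneg`, `production_density_le`, `production_le_two_aplus_F` : the inertial bracket
  N_F = ∫ σ (2ℓ + ρ - 2ρ̄) with ρ̄ = 𝒥/Z < 1 is ≤ ‖α⁺‖∞ (2F - ρ̄ Z) ≤ 2 ‖α⁺‖∞ F.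

All statements are closed real-arithmetic facts; the PDE bookkeeping (which integral is which)
is in `pub-nsfunc-nogo/ephi/N19-EPHI.md` §2 and census-1 METHODS (cc.33).
-/

namespace Summit.NavierStokesRegularity.FunctionalMining.NoGo.EPhiImmuneC2

/-- Tangential Hessian eigenvalue φ′/s = 2ℓ + ρ ≥ 2 when ℓ ≥ 1 and ρ ≥ 0. -/
theorem tangential_ge_two (ℓ ρ : ℝ) (hℓ : 1 ≤ ℓ) (hρ : 0 ≤ ρ) : 2 ≤ 2 * ℓ + ρ := by
  linarith

/-- Radial Hessian eigenvalue φ″ = 2ℓ + 3ρ + ρ(1-ρ) ≥ 2 when ℓ ≥ 1 and 0 ≤ ρ < 1. -/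
theorem radial_ge_two (ℓ ρ : ℝ) (hℓ : 1 ≤ ℓ) (hρ : 0 ≤ ρ) (hρ1 : ρ < 1) :
    2 ≤ 2 * ℓ + 3 * ρ + ρ * (1 - ρ) := by
  nlinarith

/-- The viscous bracket of the RQ-normalised functional is nonpositive:
with `D ≥ 2νP`, `0 ≤ J ≤ Z`, all quantities nonnegative, `-D + (2νP/Z)·J - (νZ/K)·J ≤ 0`. -/
theorem viscous_bracket_nonpos (ν P Z K J D : ℝ) (hν : 0 ≤ ν) (hP : 0 ≤ P) (hZ : 0 < Z)
    (hK : 0 < K) (hJ0 : 0 ≤ J) (hJ : J ≤ Z) (hD : 2 * ν * P ≤ D) :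
    -D + (2 * ν * P / Z) * J - (ν * Z / K) * J ≤ 0 := by
  have h1 : (2 * ν * P / Z) * J ≤ 2 * ν * P := by
    have hq : J / Z ≤ 1 := by
      rw [div_le_one hZ]; exact hJ
    have h2 : (2 * ν * P / Z) * J = 2 * ν * P * (J / Z) := by
      field_simp
    rw [h2]
    have h3 : 0 ≤ 2 * ν * P := by positivity
    calc 2 * ν * P * (J / Z) ≤ 2 * ν * P * 1 := by
          exact mul_le_mul_of_nonneg_left hq h3
      _ = 2 * ν * P := by ring
  have h4 : 0 ≤ (ν * Z / K) * J := by positivity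
  linarith

/-- The inertial weight 2ℓ + ρ - 2ρ̄ is nonnegative (ℓ ≥ 1, ρ ≥ 0, ρ̄ < 1). -/
theorem weight_nonneg (ℓ ρ ρbar : ℝ) (hℓ : 1 ≤ ℓ) (hρ : 0 ≤ ρ) (hρbar : ρbar < 1) :
    0 ≤ 2 * ℓ + ρ - 2 * ρbar := by
  linarith

/-- Pointwise: σ·w ≤ α⁺ s² · w for a nonnegative weight w when σ ≤ α⁺ s². -/
theorem production_density_le (σ aplus s w : ℝ) (hσ : σ ≤ aplus * s ^ 2) (hw : 0 ≤ w) :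
    σ * w ≤ aplus * s ^ 2 * w :=
  mul_le_mul_of_nonneg_right hσ hw

/-- Integrated: N ≤ α⁺ (2F - ρ̄ Z) ≤ 2 α⁺ F. -/
theorem production_le_two_aplus_F (N aplus F Z ρbar : ℝ) (ha : 0 ≤ aplus) (hZ : 0 ≤ Z)
    (hρbar : 0 ≤ ρbar) (hN : N ≤ aplus * (2 * F - ρbar * Z)) : N ≤ 2 * aplus * F := by
  have h : 0 ≤ aplus * (ρbar * Z) := by positivity
  nlinarith

/-- Assembly of the row: if `dF = N + V` with `V ≤ 0` (viscous bracket) and `N ≤ 2 α⁺ F`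
(inertial bracket) then `dF ≤ 2 · α⁺ · F - (-V)` with the E0 dissipation `-V ≥ 0`. -/
theorem row_holds_C_two (dF N V aplus F : ℝ) (hdF : dF = N + V) (hV : V ≤ 0)
    (hN : N ≤ 2 * aplus * F) : dF ≤ 2 * aplus * F - (-V) ∧ 0 ≤ -V := by
  constructor <;> linarith

end Summit.NavierStokesRegularity.FunctionalMining.NoGo.EPhiImmuneC2
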